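/-
Origin: expansion seat `planner-pub-hodgecm-mc-axioms-1-g14-0`, handover #W177 2026-08-20T15:53:55Z md5 763e3e7b76a6 (PKG 789e75e81741 → 763e3e7b76a6; 362 l.; MECHANICAL (iib-R) rewrite v3.1 of the PKG file as it stands (29 token edits; rules R1x2+RX[h₂']x27)) (`HOME/mc/pub-hodgecm-mc-axioms-1-g14/revendor/kit-r55/stage55/HodgeCM/Model/Sanity/ZeroSchwartzIndex.lean`, md5 763e3e7b76a6, 362 lines);
landed by the gen-22 packager (p-g22) in gate run 55 REPLACES the earlier landed copy of `HodgeCM/Model/Sanity/ZeroSchwartzIndex.lean` (seat copy carried the packager Origin header of an earlier run (stripped)).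
-/
/-
Origin: SANITY lane `planner-pub-hodgecm-mc-sanity-1-g5-0` (unit pub-hodgecm-mc-sanity-1-g5, gen 5 of mc-sanity-1,
node SAN-12), 2026-08-19.  v2 («level-free ιinf» JOINT CUT, RUN-35 packet member M12) REPLACEMENT of the RUN-34 module
`HodgeCM/Model/Sanity/ZeroSchwartzIndex.lean` (v1 cb23a758c136, installed RUN-34 cut A): § 7 (`hRat_degS_lev`) DELETED — the
level-free `hRat_degS` lives in `Sanity/ThetaAdelicSideDegenerate″` (M3, 48a1ca2e3628) and feeds the pin's own `hRat` field;
§ 6 `hι_degS_lev` DELETED with the binder `hι` (gone from E R10″, glue-1 #316); the two `degS_ιinf` rewrites of § 6 are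
level-free.  Everything else byte-identical to v1.  Imports the packet members `HodgeCM.Model.E2InstanceR10` (M7, R10″) and
`HodgeCM.Model.Sanity.PinThetaCollapse` (M5) and the unchanged `HodgeCM.Model.Sanity.BridgeSanity`; imported by
`Sanity/DegenerateClosure″` (M13).  Install with the packet only (atomic), in the custodian's slot (after M7).
KERNEL: 0 records, 0 `Prop` definitions, 0 hypotheses minted, nothing cited; one instance, keyed on this file's own
`WmInput.zeroSK`.  Expected `#print axioms`: ⊆ {propext, Classical.choice, Quot.sound}.
-/
import Summits.HodgeConjecture.HodgeCM.Model.E2InstanceR10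
import Summits.HodgeConjecture.HodgeCM.Model.Sanity.BridgeSanity
import Summits.HodgeConjecture.HodgeCM.Model.Sanity.PinThetaCollapse_2

/-!
# SAN-12 — the W-side binders of E R10 over the ZERO Schwartz index space, and `gen12` over `degS`

MODEL-CONSTRUCTION sub-cell, SANITY lane (unit `pub-hodgecm-mc-sanity-1-g5`, node SAN-12).  KERNEL only: no records,
no `Prop` definitions, no hypotheses minted, nothing cited, no global instances on Mathlib types, complete proofs.

E R10 (`Model.perL_picardCM_r10core`, glue-1-g4) takes the Weil–theta side as ONE data binder
`W : ∀ V c, WmInput V c.D` (mc-unitary-1-g3 `WmInstance` rev-c) and reads it through `wm := wmOfInput W`,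
`lin := linOfInput W`.  Exactly four `Prop`/`Nonempty` binders of R10 mention `W`: `gen12`, `real34`, `hyp12`, `hyp34`
(`C` and `hol` are `S`-side: they quantify over `thetaSpaceInputIn … (S V c)` only).  This file profiles them on the
degenerate inhabitant of the `W` slot that every `W` carries inside itself:

* §2 `WmInput.zeroSK W := { W with SK := {0} }` — the SAME carriers, Weil action `ρ`, majorants, rationality and
  currency maps, with PerL's K-type index space `𝒮^κ` (l. 341) shrunk to the zero subspace.  It is again a `WmInput`
  (`SK_stable` by `map_zero`), so the slot does not see the size of `𝒮^κ`; `↥(wmOf' hP W.zeroSK).SK` is a one-point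
  space and every theta kernel `θ_Φ` of it is `0` (`θ_wmOf'_zeroSK`, from unitary-1's `LinearStr` instance).
* §3 Hence E's core `coreOf U emb cover (wmOfInput (zeroSK ∘ W)) Θ` has ZERO KERNELS (gen-1/2 `ZeroKernels`,
  `Sanity/DegenerateCores`, `Sanity/BridgeSanity`) for EVERY `W`, `Θ`, `emb`, `cover` — in particular over the honest
  `S`, `μ` of E — and the zero-kernel census of gen 1/2 applies verbatim to R10's model:
  `real34` is FREE (`real34_zeroSK`, `wset := ∅`); `gen12` holds IFF the C5′ meeting statement `Gen12MeetAt V c` of the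
  context does, i.e. iff `Λ = emb ∘ ∪` kills every `(12)` theta pair of `Θ` (`gen12_zeroSK_iff`,
  `gen12_zeroSK_iff_Λ`) — the one W-side binder that can reject `W⊥` against honest periods.
* §1/§4 NEW for the records introduced after gen 2: the six-field 𝒯-free hyperbolic side `ArchC.HypSmoothSide`
  (pv06-g7) is inhabited over ANY isolation core whose Schwartz index type is a subsingleton, for any kind map,
  scalings, vacuum characters and chart (`HypSmoothSide.ofSubsingleton`: no pure tensor but `0`, dense because
  `𝒮^κ = {0}`, `omg_ins` / `smooth` are identities in a one-point space, the curves `e_b` constant `1`); so R10's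
  `hyp12` / `hyp34` (`HypSmoothCore12/34 … (ℓ := linOfInput W V c)`) are FREE over `zeroSK ∘ W` for every `S`, `μ`
  (`hyp12_zeroSK`, `hyp34_zeroSK`, stated for all residual inputs `R12 R34 hA`, hence for E's
  `side12 (d12Of μ)`, `side34 (d34Of μ)`, `(analyticKM …).toAnalytic`).
* §5 Over this lane's archimedean-trivial side `degS` (SAN-10a) the remaining binder `gen12` is FREE as well, for
  EVERY `W` and `μ` (`gen12_degS`): SAN-11's `gen12FunBridgeOfCollapse` needs one character and one Schwartz datum, and
  both exist outright — `NumberField.SeesawTorus.nonempty_allowedChars` (PKG kernel, every archimedean type) and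
  `W.SK_zero`.

READING (census, MODEL-N ±0).  Over `(zeroSK ∘ W, S, μ)`: `real34`, `hyp12`, `hyp34` FREE; `gen12` ⟺ `Gen12MeetAt`
(period-side content of `Θ`, no W-content left).  Over `(W, degS, μ)`: all four FREE (with SAN-11: `hLiu`, `transl`,
`thetaSat`, `ThetaSubAt` free, `thetaWedge` refuted).  So none of `real34 / hyp12 / hyp34` constrains `𝒮^κ` away from
`0`: the non-triviality of PerL's `𝒮^κ` enters E only through `gen12` read against honest periods (gen-2's no-go
`false_of_zeroKernelsAt_funBridge` is the model-axiom form of the same fact) and through the DATA provenance of `W`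
(vacancy (v19-a), unitary-1's `wmInputCM`).  Nothing here is a defect claim; it locates content.
-/

set_option autoImplicit false

noncomputable section

open Filter
open scoped Topology InnerProductSpace

namespace HodgeCM

/-! ## §1  The 𝒯-free hyperbolic side over a one-point Schwartz index space (any isolation core) -/

namespace PerL34.ArchC.HypSmoothSide

open HodgeCM.Prior.Perl34File HodgeCM.Prior.Perl34File.Perl34
open HodgeCM.PerL34.Fock HodgeCM.PerL34.Fock.PrintDict

variable {H HG CG G SK SigIdx SigIdxG : Type*}
variable [NormedAddCommGroup H] [InnerProductSpace ℂ H] [CompleteSpace H]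
variable [NormedAddCommGroup HG] [InnerProductSpace ℂ HG] [CompleteSpace HG]
variable [NormedAddCommGroup CG] [NormedSpace ℂ CG]
variable [Group G] [TopologicalSpace G] [TopologicalSpace SK] [AddCommGroup SK] [Module ℂ SK]

/-- **Every six-field 𝒯-free hyperbolic side is inhabited when `𝒮^κ` is a one-point space** — for ANY kind map,
scalings, vacuum characters and torus chart: the pure-tensor family is the single map `0` (indexed by `PUnit`), dense
since the whole space is `{0}`; `omg_ins` and the `Σ₁₂`-smoothness field hold because all values lie in a subsingleton;
the curves `e_b` are the constant `1`. -/
def ofSubsingleton [Subsingleton SK] (C : IsolationCore H HG CG G SK SigIdx SigIdxG) (P : C4a.PointedCore C)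
    (RP : Type) [Fintype RP] [DecidableEq RP] (kind : RP → PlaceKind) (lam : RP → ℂ) (hlam : ∀ b, lam b ≠ 0)
    (vac : RP → (Circle × Circle →* Circle)) (ιT : (printPlaces RP kind lam hlam vac).Tg →* G) :
    HypSmoothSide C P RP kind lam hlam vac ιT where
  FinIdx := PUnit
  ins _ := 0
  dense x := by
    rw [Subsingleton.elim x 0]
    exact subset_closure (Submodule.zero_mem _)
  omg_ins _ _ _ := Subsingleton.elim _ _
  e _ _ _ := 1
  smooth _ _ _ _ := tendsto_const_nhds.congr fun _ => Subsingleton.elim _ _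

end PerL34.ArchC.HypSmoothSide

/-! ## §2  The zero Schwartz index space inside any `W`-input -/

namespace Model

open Literature.AlgebraicGeometry.ShimuraVarieties
open Literature.NumberTheory.Weil1964 Literature.Theta

namespace WmInput

variable {L : CMField} {ι₁ : L →+* ℂ} {V : HermSpace3 L ι₁} {S : StubTree.SeesawDatum L}

/-- **`W` with PerL's `𝒮^κ` shrunk to `{0}`** — every other field of `W` verbatim. -/
def zeroSK (W : WmInput V S) : WmInput V S :=
  { W with
    SK := {0}
    SK_stable := fun h Φ hΦ => by
      rw [Set.mem_singleton_iff] at hΦ ⊢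
      rw [hΦ, map_zero]
    SK_zero := Set.mem_singleton _
    SK_add := fun hΦ hΨ => by
      rw [Set.mem_singleton_iff] at hΦ hΨ ⊢
      rw [hΦ, hΨ, add_zero]
    SK_smul := fun a _ hΦ => by
      rw [Set.mem_singleton_iff] at hΦ ⊢
      rw [hΦ, smul_zero] }

variable (W : WmInput V S)

/-- (Ported verbatim from the HodgeCMPerL package; no docstring in the source.) -/
@[simp] theorem zeroSK_SK : W.zeroSK.SK = {0} := rfl
/-- (Ported verbatim from the HodgeCMPerL package; no docstring in the source.) -/
theorem zeroSK_ρ : W.zeroSK.ρ = W.ρ := rfl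
/-- (Ported verbatim from the HodgeCMPerL package; no docstring in the source.) -/
theorem zeroSK_eV : W.zeroSK.eV = W.eV := rfl
/-- (Ported verbatim from the HodgeCMPerL package; no docstring in the source.) -/
theorem zeroSK_eW : W.zeroSK.eW = W.eW := rfl

variable (hP : PrintFact_unitaryCompact)

/-- The index type of the produced model `wmOf' hP W.zeroSK` is a one-point space. -/
instance subsingleton_SK_wmOf'_zeroSK : Subsingleton ↥(wmOf' hP W.zeroSK).SK :=
  ⟨fun Φ Ψ => Subtype.ext ((Set.mem_singleton_iff.mp Φ.2).trans (Set.mem_singleton_iff.mp Ψ.2).symm)⟩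

/-- **Every theta kernel of `wmOf' hP W.zeroSK` is zero** (unitary-1's `LinearStr` instance: `θ_0 = 0`). -/
theorem θ_wmOf'_zeroSK (Φ : (wmOf' hP W.zeroSK).SK) : (wmOf' hP W.zeroSK).θ Φ = 0 := by
  rw [Subsingleton.elim Φ 0]
  exact (wmOf' hP W.zeroSK).θ_zero

end WmInput

/-! ## §3  E R10's core at `zeroSK ∘ W` has ZERO KERNELS — every `Θ`, `emb`, `cover` (so every `S`, `μ`) -/

namespace Sanity

open HodgeCM.Universe (SideData ThetaModel AdelicThetaCore AdelicTorusCore)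
open HodgeCM.PerL34 HodgeCM.PerL34.ArchC
open Literature.AlgebraicGeometry.HodgeTheory Literature.NumberTheory.Automorphic.PicardCM

section Generic

variable {U : Universe}
  (emb : ∀ {L : CMField} {ι₁ : L →+* ℂ} {V : HermSpace3 L ι₁} (Γ : Level V),
    U.CohC (U.pms L ι₁ V Γ) 2 →ₗ[ℂ] (V.latticeModel printFact_unitaryCompact_holds).toQuotientModel.H)
  (cover : ∀ {L : CMField} {ι₁ : L →+* ℂ} {V : HermSpace3 L ι₁} (Γ Γ' : Level V),
    Γ'.Γ ≤ Γ.Γ → U.Mor (U.pms L ι₁ V Γ') (U.pms L ι₁ V Γ))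
  (W : ∀ {L : CMField} {ι₁ : L →+* ℂ} (V : HermSpace3 L ι₁) (c : SeesawCtx L), WmInput V c.D)
  (Theta : ∀ {L : CMField} {ι₁ : L →+* ℂ} (V : HermSpace3 L ι₁), SeesawCtx L → Fin 4 → ∀ Γ : Level V,
    Set (U.CohC (U.pms L ι₁ V Γ) 1))
  (h : Bool) (d12 d34 : ∀ {L : CMField}, SeesawCtx L → SideData L)

/-- **Zero kernels at `zeroSK ∘ W`, any universe.** -/
theorem zeroKernels_coreOf_zeroSK :
    (coreOf U emb cover (wmOfInput fun V c => (W V c).zeroSK) Theta).ZeroKernels :=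
  fun V c Φ => (W V c).θ_wmOf'_zeroSK printFact_unitaryCompact_holds Φ

variable {L : CMField} {ι₁ : L →+* ℂ} (V : HermSpace3 L ι₁) (c : SeesawCtx L)

/-- (Ported verbatim from the HodgeCMPerL package; no docstring in the source.) -/
theorem zeroKernelsAt_coreOf_zeroSK :
    (coreOf U emb cover (wmOfInput fun V c => (W V c).zeroSK) Theta).ZeroKernelsAt V c :=
  fun Φ => (W V c).θ_wmOf'_zeroSK printFact_unitaryCompact_holds Φ

/-! ## §4  The four W-side binders over `zeroSK ∘ W` (any `Θ`, side data, residual inputs) -/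

/-- **`real34` is FREE over `zeroSK ∘ W`** (gen-2 `real34FunBridge_of_zeroKernelsAt`: `wset := ∅`). -/
theorem real34_zeroSK :
    Nonempty (((coreOf U emb cover (wmOfInput fun V c => (W V c).zeroSK) Theta).thetaModel h d12 d34).Real34FunBridge
      V c) :=
  ⟨AdelicThetaCore.real34FunBridge_of_zeroKernelsAt h d12 d34 (zeroKernelsAt_coreOf_zeroSK emb cover W Theta V c)⟩

/-- **`gen12` over `zeroSK ∘ W` holds IFF the C5′ meeting statement of the context does** (gen-2
`nonempty_gen12FunBridge_iff_gen12MeetAt_of_zeroKernelsAt`; the character and the Schwartz datum it needs to name the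
vacuous generator exist outright: `nonempty_allowedChars`, `0 ∈ {0}`). -/
theorem gen12_zeroSK_iff :
    Nonempty (((coreOf U emb cover (wmOfInput fun V c => (W V c).zeroSK) Theta).thetaModel h d12 d34).Gen12FunBridge
      V c) ↔
    ((coreOf U emb cover (wmOfInput fun V c => (W V c).zeroSK) Theta).thetaModel h d12 d34).Gen12MeetAt V c := by
  obtain ⟨χ₀⟩ := NumberField.SeesawTorus.nonempty_allowedChars (L := (L : Type)) (d12 c).m₁ (d12 c).m₂
  exact AdelicThetaCore.nonempty_gen12FunBridge_iff_gen12MeetAt_of_zeroKernelsAt h d12 d34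
    (zeroKernelsAt_coreOf_zeroSK emb cover W Theta V c) χ₀ (⟨0, (W V c).zeroSK.SK_zero⟩ : ↥(W V c).zeroSK.SK)

/-- … equivalently IFF `Λ = emb ∘ ∪` kills every `(12)` theta pair of `Θ` at `(V, c)` (gen-2
`nonempty_gen12FunBridge_iff_of_zeroKernelsAt`) — the binder's whole content over `zeroSK ∘ W` is period-side. -/
theorem gen12_zeroSK_iff_Λ :
    Nonempty (((coreOf U emb cover (wmOfInput fun V c => (W V c).zeroSK) Theta).thetaModel h d12 d34).Gen12FunBridge
      V c) ↔
    ∀ (Γ : Level V) (ω₁ ω₂ : U.CohC (U.pms L ι₁ V Γ) 1), ω₁ ∈ Theta V c 0 Γ → ω₂ ∈ Theta V c 1 Γ →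
      ((coreOf U emb cover (wmOfInput fun V c => (W V c).zeroSK) Theta).thetaModel h d12 d34).Λ Γ ω₁ ω₂ = 0 := by
  obtain ⟨χ₀⟩ := NumberField.SeesawTorus.nonempty_allowedChars (L := (L : Type)) (d12 c).m₁ (d12 c).m₂
  exact AdelicThetaCore.nonempty_gen12FunBridge_iff_of_zeroKernelsAt h d12 d34
    (zeroKernelsAt_coreOf_zeroSK emb cover W Theta V c) χ₀ (⟨0, (W V c).zeroSK.SK_zero⟩ : ↥(W V c).zeroSK.SK)

end Generic

section Hyp

variable {U : Universe} {hP : PrintFact_unitaryCompact} (C : U.AdelicTorusCore hP)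
  (R12 : ∀ {L : CMField} {ι₁ : L →+* ℂ} (V : HermSpace3 L ι₁) (c : SeesawCtx L), C.Rest12 V c)
  (R34 : ∀ {L : CMField} {ι₁ : L →+* ℂ} (V : HermSpace3 L ι₁) (c : SeesawCtx L), C.Rest34 V c)
  (hA : (C.rtc R12 R34).Analytic)
  {L : CMField} {ι₁ : L →+* ℂ} (V : HermSpace3 L ι₁) (c : SeesawCtx L)

/-- **The (12) 𝒯-free hyperbolic printed core of ANY end state is inhabited at a context whose `𝒮^κ` is a one-point
space** (kind `D₁₂` everywhere, `λ := 1`; side := `HypSmoothSide.ofSubsingleton`). -/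
theorem nonempty_hypSmoothCore12_of_subsingleton [ℓ : (C.wm V c).LinearStr] [hS : Subsingleton ↥(C.wm V c).SK] :
    Nonempty (C.HypSmoothCore12 R12 R34 hA V c) := by
  classical
  haveI : Subsingleton ((ThetaModel.ofRegCarrier (C.rtc R12 R34) hA).SK V c) := hS
  exact ⟨{ kind := fun _ => .delta, lam := fun _ => 1, hlam := fun _ => one_ne_zero,
           side := HypSmoothSide.ofSubsingleton _ _ _ _ _ _ _ _ }⟩

/-- **… and the (34) one.** -/
theorem nonempty_hypSmoothCore34_of_subsingleton [ℓ : (C.wm V c).LinearStr] [hS : Subsingleton ↥(C.wm V c).SK] :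
    Nonempty (C.HypSmoothCore34 R12 R34 hA V c) := by
  classical
  haveI : Subsingleton ((ThetaModel.ofRegCarrier (C.rtc R12 R34) hA).SK V c) := hS
  exact ⟨{ kind := fun _ => .delta, lam := fun _ => 1, hlam := fun _ => one_ne_zero,
           side := HypSmoothSide.ofSubsingleton _ _ _ _ _ _ _ _ }⟩

end Hyp

section HypE

variable {U : Universe}
  (emb : ∀ {L : CMField} {ι₁ : L →+* ℂ} {V : HermSpace3 L ι₁} (Γ : Level V),
    U.CohC (U.pms L ι₁ V Γ) 2 →ₗ[ℂ] (V.latticeModel printFact_unitaryCompact_holds).toQuotientModel.H)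
  (cover : ∀ {L : CMField} {ι₁ : L →+* ℂ} {V : HermSpace3 L ι₁} (Γ Γ' : Level V),
    Γ'.Γ ≤ Γ.Γ → U.Mor (U.pms L ι₁ V Γ') (U.pms L ι₁ V Γ))
  (W : ∀ {L : CMField} {ι₁ : L →+* ℂ} (V : HermSpace3 L ι₁) (c : SeesawCtx L), WmInput V c.D)
  (Theta : ∀ {L : CMField} {ι₁ : L →+* ℂ} (V : HermSpace3 L ι₁), SeesawCtx L → Fin 4 → ∀ Γ : Level V,
    Set (U.CohC (U.pms L ι₁ V Γ) 1))
  (h : Bool)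
  (R12 : ∀ {L : CMField} {ι₁ : L →+* ℂ} (V : HermSpace3 L ι₁) (c : SeesawCtx L),
    ((coreOf U emb cover (wmOfInput fun V c => (W V c).zeroSK) Theta).toCore h).Rest12 V c)
  (R34 : ∀ {L : CMField} {ι₁ : L →+* ℂ} (V : HermSpace3 L ι₁) (c : SeesawCtx L),
    ((coreOf U emb cover (wmOfInput fun V c => (W V c).zeroSK) Theta).toCore h).Rest34 V c)
  (hA : (((coreOf U emb cover (wmOfInput fun V c => (W V c).zeroSK) Theta).toCore h).rtc R12 R34).Analytic)
  {L : CMField} {ι₁ : L →+* ℂ} (V : HermSpace3 L ι₁) (c : SeesawCtx L)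

/-- **`hyp12` is FREE over `zeroSK ∘ W`** — E R10's record at `lin := linOfInput (zeroSK ∘ W)`, for all residual
inputs (E: `R12 := side12 (d12Of μ)`, `R34 := side34 (d34Of μ)`, `hA := (analyticKM …).toAnalytic`). -/
theorem hyp12_zeroSK :
    Nonempty (((coreOf U emb cover (wmOfInput fun V c => (W V c).zeroSK) Theta).toCore h).HypSmoothCore12 R12 R34 hA
      V c (ℓ := linOfInput (fun V c => (W V c).zeroSK) V c)) :=
  nonempty_hypSmoothCore12_of_subsingleton _ R12 R34 hA V c (ℓ := linOfInput (fun V c => (W V c).zeroSK) V c)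
    (hS := (W V c).subsingleton_SK_wmOf'_zeroSK printFact_unitaryCompact_holds)

/-- **`hyp34` is FREE over `zeroSK ∘ W`.** -/
theorem hyp34_zeroSK :
    Nonempty (((coreOf U emb cover (wmOfInput fun V c => (W V c).zeroSK) Theta).toCore h).HypSmoothCore34 R12 R34 hA
      V c (ℓ := linOfInput (fun V c => (W V c).zeroSK) V c)) :=
  nonempty_hypSmoothCore34_of_subsingleton _ R12 R34 hA V c (ℓ := linOfInput (fun V c => (W V c).zeroSK) V c)
    (hS := (W V c).subsingleton_SK_wmOf'_zeroSK printFact_unitaryCompact_holds)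

end HypE

/-! ## §5  Over the archimedean-trivial side `degS`: `gen12` is FREE for every `W` and `μ` -/

section DegS

variable (hHD : exists_isReal_hodgeModel) (hI : hodgePQ_independent_of_hodgeModel)
  (h₁ : BallQuotientUniformised)  (h₃ : CMAbelianVarietyRealised) (h : Bool)
  (emb : ∀ {L : CMField} {ι₁ : L →+* ℂ} {V : HermSpace3 L ι₁} (Γ : Level V),
    (picardCMUniverse hHD hI h₁ h₃).CohC ((picardCMUniverse hHD hI h₁ h₃).pms L ι₁ V Γ) 2 →ₗ[ℂ]
      (V.latticeModel printFact_unitaryCompact_holds).toQuotientModel.H)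
  (cover : ∀ {L : CMField} {ι₁ : L →+* ℂ} {V : HermSpace3 L ι₁} (Γ Γ' : Level V),
    Γ'.Γ ≤ Γ.Γ → (picardCMUniverse hHD hI h₁ h₃).Mor ((picardCMUniverse hHD hI h₁ h₃).pms L ι₁ V Γ')
      ((picardCMUniverse hHD hI h₁ h₃).pms L ι₁ V Γ))
  (W : ∀ {L : CMField} {ι₁ : L →+* ℂ} (V : HermSpace3 L ι₁) (c : SeesawCtx L), WmInput V c.D)
  (μ : ∀ {L : CMField}, SeesawCtx L → Fin 4 → NumberField.InfinitePlace L → ℤ)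
  {L : CMField} {ι₁ : L →+* ℂ} (V : HermSpace3 L ι₁) (c : SeesawCtx L)

/-- **`gen12` over `degS` is FREE, every `W`, `μ`, `emb`, `cover`** (SAN-11 `gen12FunBridgeOfCollapse` at a character
from `nonempty_allowedChars` and the Schwartz datum `0 ∈ 𝒮^κ`). -/
theorem gen12_degS :
    Nonempty ((thetaModelOf hHD hI h₁ h₃ h emb cover (wmOfInput W)
      (thetaOf _ (thetaClassInputOf _ (fun V c => thetaSpaceInputOf hHD hI h₁ h₃ degS V c))) (d12Of μ)
      (d34Of μ)).Gen12FunBridge V c) := by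
  obtain ⟨χ₀⟩ := NumberField.SeesawTorus.nonempty_allowedChars (L := (L : Type)) (d12Of μ c).m₁ (d12Of μ c).m₂
  exact ⟨gen12FunBridgeOfCollapse _ V c
    (theta_thetaModelOf_degS_eq hHD hI h₁ h₃ h emb cover (wmOfInput W) (d12Of μ) (d34Of μ) V c) χ₀
    (⟨0, (W V c).SK_zero⟩ : ↥(W V c).SK)⟩

/-- The same in the shape of R10's binder (`GoodCtx → finrank 6 → …`; neither hypothesis is used). -/
theorem gen12_degS' :
    (thetaModelOf hHD hI h₁ h₃ h emb cover (wmOfInput W)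
      (thetaOf _ (thetaClassInputOf _ (fun V c => thetaSpaceInputOf hHD hI h₁ h₃ degS V c))) (d12Of μ)
      (d34Of μ)).GoodCtx ι₁ c → Module.finrank ℚ c.K = 6 →
    Nonempty ((thetaModelOf hHD hI h₁ h₃ h emb cover (wmOfInput W)
      (thetaOf _ (thetaClassInputOf _ (fun V c => thetaSpaceInputOf hHD hI h₁ h₃ degS V c))) (d12Of μ)
      (d34Of μ)).Gen12FunBridge V c) :=
  fun _ _ => gen12_degS hHD hI h₁ h₃ h emb cover W μ V c

end DegS

/-! ## §6  `hol` over an archimedean-trivial side is ORIENTATION-BLIND: every restricted theta form is `0` -/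

section Hol

open HodgeCM.Model.ThetaSpace
open Literature.Geometry.ComplexHyperbolic.BallModel (U21)
open Literature.NumberTheory.Automorphic (relNormOneIdeles relNormOneRat)

variable (hHD : exists_isReal_hodgeModel) (hI : hodgePQ_independent_of_hodgeModel)
  (h₁ : BallQuotientUniformised)  (h₃ : CMAbelianVarietyRealised)
  {L : CMField} {ι₁ : L →+* ℂ} {V : HermSpace3 L ι₁} {c : SeesawCtx L}

/-- **Along a trivial archimedean inclusion every restricted theta form of every product `K`-type datum is `0`**
(SAN-11 `restrictHom_apply_eq_zero_of_trivial` + theta-3 #9 `thetaSpaceInputIn_tau_rigid`). -/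
theorem restrictedThetaForm_pin_eq_zero (Sv : ThetaAdelicSide V c) (hV : IsAnisotropic L V.Hm)
    (hι : ∀ x : U21, Sv.ιinf x = 1) {k : Fin 4} {N : ℕ}
    (B : ProductKTypeData (thetaSpaceInputIn hHD hI h₁ h₃ Sv hV) k N)
    (f : C(relNormOneIdeles (thetaSpaceInputIn hHD hI h₁ h₃ Sv hV).K (thetaSpaceInputIn hHD hI h₁ h₃ Sv hV).L ⧸
      relNormOneRat (thetaSpaceInputIn hHD hI h₁ h₃ Sv hV).K (thetaSpaceInputIn hHD hI h₁ h₃ Sv hV).L, ℂ)) :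
    B.restrictedThetaForm f = 0 :=
  restrictHom_apply_eq_zero_of_trivial _ B.isLevelCorrected B.isWeightMatched hι
    (thetaSpaceInputIn_tau_rigid hHD hI h₁ h₃ Sv hV) _

/-- **Hence R10's `hol` holds over such a side for EVERY product datum and EITHER orientation convention of `Hol`**
(`0 ∈ Hol`): the degenerate side cannot pin `𝔭′⁻ ↔ ∂̄` (model1-g4 02:58:27Z (ASM)); that check must be made on an
explicit vector.  (Over `degS` the `ArchKTypeData` fibre is moreover EMPTY for `N ≠ 0`, SAN-10b
`isEmpty_archKTypeData_pin_degS`, so E's `hol` is vacuous there twice over.) -/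
theorem hol_pin_of_trivial (Sv : ThetaAdelicSide V c) (hV : IsAnisotropic L V.Hm)
    (hι : ∀ x : U21, Sv.ιinf x = 1) {k : Fin 4} {N : ℕ}
    (B : ProductKTypeData (thetaSpaceInputIn hHD hI h₁ h₃ Sv hV) k N) :
    ∀ f ∈ ((thetaSpaceInputIn hHD hI h₁ h₃ Sv hV).P k).weightFunctions,
      B.restrictedThetaForm f ∈ ((thetaSpaceInputIn hHD hI h₁ h₃ Sv hV).D B.Γ₀).Hol := fun f _ => by
  rw [restrictedThetaForm_pin_eq_zero hHD hI h₁ h₃ Sv hV hι B f]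
  exact Submodule.zero_mem _

/-- **`hol` over `degS`** (SAN-10a: `ιinf := 1`), every product datum, level, type index and `N`. -/
theorem hol_degS (V : HermSpace3 L ι₁) (c : SeesawCtx L) (hV : IsAnisotropic L V.Hm) {k : Fin 4} {N : ℕ}
    (B : ProductKTypeData (thetaSpaceInputIn hHD hI h₁ h₃ (degS V c) hV) k N) :
    ∀ f ∈ ((thetaSpaceInputIn hHD hI h₁ h₃ (degS V c) hV).P k).weightFunctions,
      B.restrictedThetaForm f ∈ ((thetaSpaceInputIn hHD hI h₁ h₃ (degS V c) hV).D B.Γ₀).Hol :=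
  hol_pin_of_trivial hHD hI h₁ h₃ (degS V c) hV (fun x => by rw [degS_ιinf, MonoidHom.one_apply]) B

end Hol

end Sanity
end Model
end HodgeCM

end
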